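import Literature.Geometry.Kaehler.RiemannianHodge
import Literature.Geometry.Kaehler.HodgeStarProofs
import Literature.Geometry.Kaehler.HodgeStarOfVolumeFormProofs
import Mathlib.Analysis.InnerProductSpace.PiL2
import Mathlib.LinearAlgebra.Basis.SMul
import HarnessLib

/-!
# The named fact `isSmoothForm_mcoderiv` is false as stated (a step metric on `ℝ²`)

`Literature/Geometry/Kaehler/RiemannianHodge.lean` records Warner's "we define an operator `δ`
from `p`-forms to `(p-1)` forms by setting `δ = (-1)^{n(p+1)+1} *d*`" (GTM 94, 6.1 (2), p. 220;
an operator on the smooth forms `E^p(M)`, since "`*` takes smooth forms to smooth forms", 4.10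
(6), p. 150) as the named fact `isSmoothForm_mcoderiv o`. Its docstring assumes a smooth metric,
but the section instances `[IsManifold I ∞ M] [IsContinuousRiemannianBundle …]
[IsContMDiffRiemannianBundle I ∞ …]` are unused by the body of this `def … : Prop` and were
therefore *not* abstracted: as elaborated, the fact quantifies over an arbitrary
`[RiemannianBundle (fun x ↦ TangentSpace I x)]` — any family of inner products on the tangent
spaces, with no continuity in the base point. This file proves that in that generality it is
**false** (`StepMetric.not_isSmoothForm_mcoderiv_stepMetric`). The correctly hypothesised closed
statement is `isSmoothForm_mcoderiv_of_isContMDiffRiemannianBundle` (discharged) in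
`RiemannianHodgeCodiffSmoothFact.lean`, the working theorem is `IsSmoothForm.mcoderiv`
(`RiemannianHodgeSmoothProofs.lean`); the sibling facts `isSmoothForm_hodgeStar` and
`mem_harmonicForms_iff` are refuted in `RiemannianHodgeRoughMetric.lean` (a nowhere-differentiable
conformal factor on `ℝ × ℝ`); the present metric is a simpler, piecewise-constant one.

## The counterexample (`namespace StepMetric`)

On `P = ℝ²` (`Fin 2 → ℝ`, sup norm, identity chart `𝓘(ℝ, P)`, `n = 2`, `k = 1`, `m = 0`) take
the *step metric* `g_x(u, v) = λ(x) u₀v₀ + λ(x)⁻¹ u₁v₁`, `λ = 1` on `{x₁ ≤ 0}`, `λ = 2` on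
`{x₁ > 0}` (`StepMetric.bundle`, a `def` supplied explicitly — never an instance), and the
standard orientation. As `det g = 1`, the basis `(√λ)⁻¹e₀, √λ e₁` is `g`-orthonormal, positively
oriented, with determinant form `dx₀ ∧ dx₁` (`Orientation.volumeForm_robust`): the Riemannian
volume form is the *constant* form `dx₀ ∧ dx₁`, so the hypothesis `ho` holds. For the smooth
`2`-form `β = x₀ · vol`, pointwise linear algebra gives `⋆β = x₀` (the discharged
`hodgeStar_volumeFormL_holds : ⋆vol = 1`), `d⋆β = dx₀` at every point (Mathlib's
`extDeriv_constOfIsEmpty` in the identity chart), and `⋆dx₀ = ⋆⟪λ⁻¹e₀, ·⟫ = λ⁻¹ dx₁` (the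
discharged two-dimensional check `hodgeStar_apply_eq_areaForm_holds : ⋆⟪v, ·⟫ = ω(v, ·)`), so
`δβ = -⋆d⋆β = -λ⁻¹ dx₁`. On `e₁` it takes the value `-λ(x)⁻¹`, jumping between `-1` and `-½`
across `{x₁ = 0}`: not continuous at the origin, hence `δβ` is not smooth (`IsSmoothForm` gives
continuity of the identity-chart representative). No junk values enter: every identity used
holds at every point.

## References

* F. W. Warner, *Foundations of Differentiable Manifolds and Lie Groups*, GTM 94 (1983), 6.1 (2)
  (p. 220), 4.10 (6) (p. 150) — the intended (smooth-metric) statement.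
-/

noncomputable section

open scoped Manifold ContDiff Topology InnerProductSpace
open Module Set ContinuousAlternatingMap

namespace Literature.Geometry.Kaehler

namespace StepMetric

/-- The model plane `ℝ²` with the sup norm (deliberately *not* an inner product space, so that no
`RiemannianBundle` instance on its tangent spaces is in scope). [folklore] -/
abbrev P : Type := Fin 2 → ℝ

/-- The step function `λ`: `1` on the closed lower half-plane `{x₁ ≤ 0}`, `2` on `{x₁ > 0}`.
[folklore] -/
def lam (x : P) : ℝ := if 0 < x 1 then 2 else 1

/-- `0 < λ`. [folklore] -/
theorem lam_pos (x : P) : 0 < lam x := by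
  unfold lam; split_ifs <;> norm_num

/-- The bilinear form `g_x(u, v) = λ(x) u₀ v₀ + λ(x)⁻¹ u₁ v₁` on `ℝ²`, as a continuous bilinear
map. [folklore] -/
def form (x : P) : P →L[ℝ] P →L[ℝ] ℝ :=
  lam x • (ContinuousLinearMap.proj 0).smulRight (ContinuousLinearMap.proj 0) +
    (lam x)⁻¹ • (ContinuousLinearMap.proj 1).smulRight (ContinuousLinearMap.proj 1)

/-- `g_x(u, v) = λ u₀ v₀ + λ⁻¹ u₁ v₁`. [folklore] -/
@[simp]
theorem form_apply (x u v : P) : form x u v = lam x * u 0 * v 0 + (lam x)⁻¹ * u 1 * v 1 := by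
  simp [form, mul_comm, mul_assoc, mul_left_comm]

/-- `g_x(u, u) = λ u₀² + λ⁻¹ u₁²`. [folklore] -/
theorem form_self_eq (x u : P) : form x u u = lam x * u 0 ^ 2 + (lam x)⁻¹ * u 1 ^ 2 := by
  rw [form_apply]; ring

/-- On the unit ball of `g_x` the sup norm is `< 2` (so that ball is von Neumann bounded).
[folklore] -/
theorem norm_lt_two_of_form_self_lt_one (x u : P) (h : form x u u < 1) : ‖u‖ < 2 := by
  rw [form_self_eq] at h
  have h12 : 1 ≤ lam x ∧ lam x ≤ 2 := by unfold lam; split_ifs <;> norm_num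
  obtain ⟨h1, h2⟩ := h12; have hl := lam_pos x
  have hli : 0 < (lam x)⁻¹ := inv_pos.2 hl
  have ha : u 0 ^ 2 < 4 := by nlinarith [mul_nonneg hli.le (sq_nonneg (u 1)), sq_nonneg (u 0)]
  have hb : u 1 ^ 2 < 4 := by
    have h3 : (lam x)⁻¹ * u 1 ^ 2 < 1 := by nlinarith [mul_nonneg hl.le (sq_nonneg (u 0))]
    have := mul_lt_mul_of_pos_left h3 hl
    rw [← mul_assoc, mul_inv_cancel₀ hl.ne', one_mul, mul_one] at this
    linarith
  have ha' : |u 0| < 2 := abs_lt.2 ⟨by nlinarith, by nlinarith⟩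
  have hb' : |u 1| < 2 := abs_lt.2 ⟨by nlinarith, by nlinarith⟩
  rw [pi_norm_lt_iff (by norm_num : (0 : ℝ) < 2), Fin.forall_fin_two]
  exact ⟨by simpa [Real.norm_eq_abs] using ha', by simpa [Real.norm_eq_abs] using hb'⟩

/-- `g_x` is positive definite. [folklore] -/
theorem form_self_pos (x : P) {u : P} (hu : u ≠ 0) : 0 < form x u u := by
  rw [form_self_eq]
  have hl := lam_pos x
  have hli : 0 < (lam x)⁻¹ := inv_pos.2 hl
  obtain h0 | h1 : u 0 ≠ 0 ∨ u 1 ≠ 0 := by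
    simpa [Function.ne_iff, Fin.exists_fin_two] using hu
  · nlinarith [mul_nonneg hli.le (sq_nonneg (u 1)), mul_pos hl (pow_pos (abs_pos.2 h0) 2),
      sq_abs (u 0)]
  · nlinarith [mul_nonneg hl.le (sq_nonneg (u 0)), mul_pos hli (pow_pos (abs_pos.2 h1) 2),
      sq_abs (u 1)]

set_option backward.isDefEq.respectTransparency false in
/-- The step metric as a Mathlib `Bundle.RiemannianMetric` on the tangent spaces of the flat plane
(that structure asks for no continuity in the base point; the unfolding of `TangentSpace 𝓘(ℝ, P) x`
to `P` uses the same `backward.isDefEq.respectTransparency` escape as Mathlib's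
`riemannianMetricVectorSpace`). [folklore] -/
def metric : Bundle.RiemannianMetric (fun x : P ↦ TangentSpace 𝓘(ℝ, P) x) where
  inner x := form x
  symm x u v := by
    change form x u v = form x v u
    simp only [form_apply]; ring
  pos x u hu := form_self_pos x hu
  continuousAt x := by
    change ContinuousAt (fun u : P ↦ form x u u) 0
    have : (fun u : P ↦ form x u u) = fun u ↦ lam x * u 0 * u 0 + (lam x)⁻¹ * u 1 * u 1 := by
      funext u; exact form_apply x u u
    rw [this]
    fun_prop
  isVonNBounded x := by
    change Bornology.IsVonNBounded ℝ {u : P | form x u u < 1}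
    refine (NormedSpace.isVonNBounded_ball ℝ P 2).subset fun u hu ↦ ?_
    rw [Metric.mem_ball, dist_zero_right]
    exact norm_lt_two_of_form_self_lt_one x u hu

/-- The step metric as a `RiemannianBundle` structure: a (reducible) `def`, supplied explicitly to
the facts under refutation and used as a *local* instance below — never a global instance.
[folklore] -/
@[reducible]
def bundle : Bundle.RiemannianBundle (fun x : P ↦ TangentSpace 𝓘(ℝ, P) x) := ⟨metric⟩

/-- `finrank ℝ ℝ² = 2`, the `Fact` consumed by `Orientation.volumeForm` (a local instance below).
[folklore] -/
theorem factFinrank : Fact (finrank ℝ P = 2) := ⟨by simp⟩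

/-- `√λ(x)` as a unit of `ℝ`. [folklore] -/
def sqrtLamUnit (x : P) : ℝˣ := Units.mk0 (Real.sqrt (lam x)) (Real.sqrt_ne_zero'.2 (lam_pos x))

/-- The column weights `(√λ)⁻¹, √λ` (product `1`: `det g = 1`). [folklore] -/
def weights (x : P) : Fin 2 → ℝˣ := ![(sqrtLamUnit x)⁻¹, sqrtLamUnit x]

/-- `∏ weights = 1`. [folklore] -/
theorem prod_weights (x : P) : ∏ i, weights x i = 1 := by
  simp [weights, Fin.prod_univ_two]

/-- The standard basis `e₀, e₁` of `T_x ℝ² = ℝ²`. [folklore] -/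
def stdBasisT (x : P) : Basis (Fin 2) ℝ (TangentSpace 𝓘(ℝ, P) x) := Pi.basisFun ℝ (Fin 2)

/-- `stdBasisT x i = eᵢ`. [folklore] -/
@[simp]
theorem stdBasisT_apply (x : P) (i : Fin 2) : stdBasisT x i = (Pi.single i 1 : P) :=
  Pi.basisFun_apply ℝ (Fin 2) i

/-- The standard orientation of `ℝ²`, on every tangent space of the flat plane. [folklore] -/
def orient (x : P) : Orientation ℝ (TangentSpace 𝓘(ℝ, P) x) (Fin 2) := (stdBasisT x).orientation

/-- The basis `(√λ)⁻¹ e₀, √λ e₁` of `T_x ℝ²`. [folklore] -/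
def scaledBasis (x : P) : Basis (Fin 2) ℝ (TangentSpace 𝓘(ℝ, P) x) :=
  (stdBasisT x).unitsSMul (weights x)

/-- `scaledBasis x 0 = (√λ)⁻¹ e₀`. [folklore] -/
theorem scaledBasis_zero (x : P) :
    scaledBasis x 0 = ((Real.sqrt (lam x))⁻¹ : ℝ) • (Pi.single 0 1 : P) := by
  rw [scaledBasis, Basis.unitsSMul_apply, Units.smul_def, stdBasisT_apply]
  simp only [weights, Matrix.cons_val_zero, Units.val_inv_eq_inv_val, sqrtLamUnit, Units.val_mk0]
  rfl

/-- `scaledBasis x 1 = √λ e₁`. [folklore] -/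
theorem scaledBasis_one (x : P) :
    scaledBasis x 1 = (Real.sqrt (lam x) : ℝ) • (Pi.single 1 1 : P) := by
  rw [scaledBasis, Basis.unitsSMul_apply, Units.smul_def, stdBasisT_apply]
  simp only [weights, Matrix.cons_val_one, Matrix.cons_val_zero, sqrtLamUnit, Units.val_mk0]
  rfl

section WithMetric

open Bundle

attribute [local instance] bundle factFinrank

/-- The inner product of the step metric on `T_x ℝ²` (definitional). [folklore] -/
theorem inner_eq (x : P) (u v : TangentSpace 𝓘(ℝ, P) x) :
    ⟪u, v⟫_ℝ = lam x * u 0 * v 0 + (lam x)⁻¹ * u 1 * v 1 :=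
  form_apply x u v

/-- `(√λ)⁻¹ e₀, √λ e₁` is `g_x`-orthonormal. [folklore] -/
theorem scaledBasis_orthonormal (x : P) : Orthonormal ℝ (scaledBasis x) := by
  have hl : 0 < lam x := lam_pos x
  have hs : Real.sqrt (lam x) ^ 2 = lam x := Real.sq_sqrt hl.le
  rw [orthonormal_iff_ite]
  intro i j
  fin_cases i <;> fin_cases j <;> rw [inner_eq] <;>
    simp [scaledBasis_zero, scaledBasis_one] <;> field_simp <;> nlinarith [hs, hl]

/-- The `g_x`-orthonormal basis `(√λ)⁻¹ e₀, √λ e₁` of `T_x ℝ²`. [folklore] -/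
def onBasis (x : P) : OrthonormalBasis (Fin 2) ℝ (TangentSpace 𝓘(ℝ, P) x) :=
  (scaledBasis x).toOrthonormalBasis (scaledBasis_orthonormal x)

/-- The underlying basis of `onBasis x` is `scaledBasis x`. [folklore] -/
theorem toBasis_onBasis (x : P) : (onBasis x).toBasis = scaledBasis x :=
  Basis.toBasis_toOrthonormalBasis _ _

/-- `onBasis` is positively oriented (the weights have product `1`). [folklore] -/
theorem orientation_onBasis (x : P) : (onBasis x).toBasis.orientation = orient x := by
  rw [toBasis_onBasis]
  have h := Basis.orientation_unitsSMul (stdBasisT x) (weights x)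
  rw [prod_weights, inv_one, one_smul] at h
  exact h

/-- **The volume form of the step metric is the standard determinant** (`det g = 1`):
`Orientation.volumeForm_robust` in the orthonormal basis `onBasis x`, and `Basis.det_unitsSMul`.
[folklore] -/
theorem volumeForm_eq (x : P) (v : Fin 2 → TangentSpace 𝓘(ℝ, P) x) :
    (orient x).volumeForm v = (stdBasisT x).det v := by
  rw [Orientation.volumeForm_robust _ (onBasis x) (orientation_onBasis x), toBasis_onBasis]
  have h := Basis.det_unitsSMul (stdBasisT x) (weights x)
  rw [prod_weights, inv_one, Units.val_one, one_smul] at h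
  exact congrArg (fun D ↦ D v) h

/-- The Riemannian volume form of the step metric evaluates as the standard determinant.
[folklore] -/
theorem riemannianVolumeForm_apply_eq (x : P) (v : Fin 2 → TangentSpace 𝓘(ℝ, P) x) :
    riemannianVolumeForm orient x v = (stdBasisT x).det v := by
  simp only [riemannianVolumeForm_apply, Orientation.volumeFormL_apply, volumeForm_eq]

/-- The Riemannian volume form of the step metric is constant (`= dx₀ ∧ dx₁`). [folklore] -/
theorem riemannianVolumeForm_eq (x : P) :
    riemannianVolumeForm orient x = riemannianVolumeForm orient 0 := by
  ext v
  rw [riemannianVolumeForm_apply_eq]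
  exact (riemannianVolumeForm_apply_eq 0 v).symm

/-- On the model vector space the chart representative of a form is the form itself (all charts
are the identity; cf. `mextDeriv_eq_extDeriv`). [folklore] -/
theorem inChart_eq_self {k : ℕ} (α : MForm 𝓘(ℝ, P) P ℝ k) (x₀ : P) : α.inChart x₀ = α := by
  funext y
  ext v
  simp [MForm.inChart_apply]
  rfl

/-- The (constant) volume form of the step metric is smooth: the hypothesis `ho` of the fact
holds for `orient`. [folklore] -/
theorem isSmoothForm_riemannianVolumeForm : IsSmoothForm (riemannianVolumeForm orient) := by
  intro x
  rw [inChart_eq_self, funext riemannianVolumeForm_eq]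
  exact contDiffWithinAt_const

/-- The smooth top-degree form `β = x₀ · vol`. [folklore] -/
def beta : MForm 𝓘(ℝ, P) P ℝ 2 := fun x ↦ (x 0) • riemannianVolumeForm orient x

/-- `β = x₀ · (dx₀ ∧ dx₁)`. [folklore] -/
theorem beta_eq : beta = fun x : P ↦ (x 0) • riemannianVolumeForm orient 0 := by
  funext x
  rw [beta, riemannianVolumeForm_eq x]
  rfl

/-- `β` is smooth. [folklore] -/
theorem isSmoothForm_beta : IsSmoothForm beta := by
  intro x
  rw [inChart_eq_self, beta_eq]
  exact ((ContinuousLinearMap.proj (R := ℝ) (φ := fun _ : Fin 2 ↦ ℝ) 0).contDiff.contDiffWithinAt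
    (s := range 𝓘(ℝ, P)) (x := extChartAt 𝓘(ℝ, P) x x)).smul contDiffWithinAt_const

/-- `⋆β = x₀` (a `0`-form): `⋆(f · vol) = f · ⋆vol = f` pointwise (`hodgeStar_volumeFormL_holds`).
[folklore] -/
theorem hodgeStar_beta (h : 1 + 1 + 0 = 2) (x : P) :
    MForm.hodgeStar orient h beta x = constOfIsEmpty ℝ (TangentSpace 𝓘(ℝ, P) x) (Fin 0) (x 0) := by
  rw [MForm.hodgeStar_apply]
  change hodgeStar (orient x) h ((x 0) • (orient x).volumeFormL) = _
  rw [map_smul, hodgeStar_volumeFormL_holds (orient x) h]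
  ext v
  simp

/-- `d⋆β = dx₀` at every point (Mathlib's `extDeriv_constOfIsEmpty` in the identity chart,
`mextDeriv_eq_extDeriv`). [folklore] -/
theorem mextDeriv_hodgeStar_beta (h : 1 + 1 + 0 = 2) (x : P) :
    mextDeriv (MForm.hodgeStar orient h beta) x =
      ofSubsingleton ℝ (TangentSpace 𝓘(ℝ, P) x) ℝ (0 : Fin 1) (ContinuousLinearMap.proj 0) := by
  have hfun : (MForm.hodgeStar orient h beta : MForm 𝓘(ℝ, P) P ℝ 0) =
      fun y ↦ constOfIsEmpty ℝ P (Fin 0) (y 0) := funext (hodgeStar_beta h)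
  rw [hfun, mextDeriv_eq_extDeriv, extDeriv_constOfIsEmpty]
  congr 1
  exact (ContinuousLinearMap.proj (R := ℝ) (φ := fun _ : Fin 2 ↦ ℝ) 0).fderiv

/-- The `1`-form `dx₀` is `⟪λ⁻¹ e₀, ·⟫` for the step metric. [folklore] -/
theorem proj_zero_eq_innerSL (x : P) :
    (ContinuousLinearMap.proj 0 : TangentSpace 𝓘(ℝ, P) x →L[ℝ] ℝ) =
      innerSL ℝ (E := TangentSpace 𝓘(ℝ, P) x) (((lam x)⁻¹ : ℝ) • (Pi.single 0 1 : P)) := by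
  ext w
  change w 0 = @inner ℝ (TangentSpace 𝓘(ℝ, P) x) _ (((lam x)⁻¹ : ℝ) • (Pi.single 0 1 : P)) w
  rw [inner_eq]
  simp [mul_inv_cancel₀ (lam_pos x).ne']

/-- **`⋆dx₀ = λ⁻¹ dx₁`** for the step metric, evaluated on `e₁`: `⋆⟪λ⁻¹e₀, ·⟫ = ω(λ⁻¹ e₀, ·)`
(`hodgeStar_apply_eq_areaForm_holds`) and `ω = vol = det` (`volumeForm_eq`). [folklore] -/
theorem hodgeStar_dx₀_apply (h : 1 + 1 = 2) (x : P) :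
    hodgeStar (orient x) h
        (ofSubsingleton ℝ (TangentSpace 𝓘(ℝ, P) x) ℝ (0 : Fin 1) (ContinuousLinearMap.proj 0))
        ![(Pi.single 1 1 : P)] = (lam x)⁻¹ := by
  rw [proj_zero_eq_innerSL x, hodgeStar_apply_eq_areaForm_holds (orient x),
    Orientation.areaForm_to_volumeForm, volumeForm_eq]
  change (Pi.basisFun ℝ (Fin 2)).det
    ![(lam x)⁻¹ • (Pi.single 0 1 : P), (Pi.single 1 1 : P)] = (lam x)⁻¹
  rw [Pi.basisFun_det, show Matrix.detRowAlternating
      ![(lam x)⁻¹ • (Pi.single 0 1 : P), (Pi.single 1 1 : P)] =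
      Matrix.det (Matrix.of ![(lam x)⁻¹ • (Pi.single 0 1 : P), (Pi.single 1 1 : P)]) from rfl,
    Matrix.det_fin_two]
  simp

/-- **`δβ = -λ⁻¹ dx₁`**: the codifferential of `β` evaluated on `e₁` is `-λ(x)⁻¹` at every point
(`δ = (-1)^{n·k+1} ⋆d⋆` with `n = 2`, `k = 1`). [folklore] -/
theorem mcoderiv_beta_apply (h : 1 + 1 + 0 = 2) (x : P) :
    mcoderiv orient h beta x ![(Pi.single 1 1 : P)] = -1 * (lam x)⁻¹ := by
  simp only [mcoderiv, Pi.smul_apply, ContinuousAlternatingMap.smul_apply, MForm.hodgeStar_apply]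
  rw [mextDeriv_hodgeStar_beta h x, hodgeStar_dx₀_apply]
  norm_num

/-- `x ↦ c · λ(x)⁻¹` (`c ≠ 0`) is not continuous at the origin: it jumps across the axis
`{x₁ = 0}` (value `c` at `0`, `c/2` at `(0, t)`, `t > 0`). [folklore] -/
theorem not_continuousAt_mul_inv_lam {c : ℝ} (hc : c ≠ 0) :
    ¬ ContinuousAt (fun x : P ↦ c * (lam x)⁻¹) 0 := by
  intro h
  rw [Metric.continuousAt_iff] at h
  obtain ⟨δ, hδ, hcδ⟩ := h (|c| / 4) (by positivity)
  have hx : dist (Pi.single 1 (δ / 2) : P) 0 < δ := by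
    rw [dist_zero_right, Pi.norm_single, Real.norm_eq_abs, abs_of_pos (by linarith)]
    linarith
  have := hcδ hx
  have hl1 : lam (Pi.single 1 (δ / 2)) = 2 := by simp [lam, hδ]
  have hl0 : lam 0 = 1 := by simp [lam]
  rw [hl1, hl0, Real.dist_eq, show c * 2⁻¹ - c * 1⁻¹ = -(c / 2) by ring, abs_neg, abs_div,
    abs_two] at this
  linarith [abs_pos.2 hc]

/-- A `1`-form on the flat plane whose value on `e₁` is `c · λ⁻¹` (`c ≠ 0`) is not smooth:
smoothness would give `C^∞`-regularity, hence continuity, of its identity-chart representative (= itself,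
`inChart_eq_self`) at the origin, contradicting `not_continuousAt_mul_inv_lam`. [folklore] -/
theorem not_isSmoothForm_of_apply_eq {γ : MForm 𝓘(ℝ, P) P ℝ 1} {c : ℝ} (hc : c ≠ 0)
    (hγ : ∀ x, γ x ![(Pi.single 1 1 : P)] = c * (lam x)⁻¹) : ¬ IsSmoothForm γ := by
  intro H
  have h0 := H 0
  rw [inChart_eq_self] at h0
  have h1 : @ContinuousAt P (P [⋀^Fin 1]→L[ℝ] ℝ) _ _ γ 0 := by
    have := h0.continuousWithinAt
    rwa [ModelWithCorners.range_eq_univ, continuousWithinAt_univ, extChartAt_self_apply] at this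
  have h2 : ContinuousAt (fun x : P ↦ (γ x : P [⋀^Fin 1]→L[ℝ] ℝ) ![(Pi.single 1 1 : P)]) 0 :=
    ((ContinuousAlternatingMap.apply ℝ P ℝ ![(Pi.single 1 1 : P)]).continuous.continuousAt).comp
      h1
  simp only [hγ] at h2
  exact not_continuousAt_mul_inv_lam hc h2

/-- **The named fact `Literature.Geometry.Kaehler.isSmoothForm_mcoderiv` is false as stated.**
For the step metric on `ℝ²` (`n = 2`, `k = 1`, `m = 0`, identity chart, standard orientation,
smooth — indeed constant — volume form) the codifferential of the smooth `2`-form `β = x₀ · vol`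
is `-λ⁻¹ dx₁`, which is not smooth. The intended statement (smooth metric; Warner (1983), 6.1 (2))
is `isSmoothForm_mcoderiv_of_isContMDiffRiemannianBundle(_holds)`
(`RiemannianHodgeCodiffSmoothFact.lean`) / `IsSmoothForm.mcoderiv`
(`RiemannianHodgeSmoothProofs.lean`). [folklore] -/
theorem not_isSmoothForm_mcoderiv_stepMetric :
    ¬ @isSmoothForm_mcoderiv P _ _ 2 factFinrank P _ 𝓘(ℝ, P) P _ _ _ bundle 1 0 orient :=
  fun H ↦ not_isSmoothForm_of_apply_eq (by norm_num) (mcoderiv_beta_apply (by norm_num))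
    (H isSmoothForm_riemannianVolumeForm (by norm_num) isSmoothForm_beta)

end WithMetric

end StepMetric

section UniversalClosure

attribute [local instance] StepMetric.factFinrank StepMetric.bundle

/-- **`isSmoothForm_mcoderiv` cannot be discharged as stated**: its universal closure over
charted spaces modelled on `ℝ²` with Riemannian bundle metrics of no regularity is false
(witness: the step metric `StepMetric.bundle` on `ℝ²` with the standard orientation,
`StepMetric.not_isSmoothForm_mcoderiv_stepMetric`; companion of
`not_forall_isSmoothForm_hodgeStar` in `RiemannianHodgeRoughMetric.lean`). [folklore] -/
theorem not_forall_isSmoothForm_mcoderiv :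
    ¬ ∀ (M : Type) [TopologicalSpace M] [ChartedSpace StepMetric.P M]
        [Bundle.RiemannianBundle (fun x : M ↦ TangentSpace 𝓘(ℝ, StepMetric.P) x)]
        (o : (x : M) → Orientation ℝ (TangentSpace 𝓘(ℝ, StepMetric.P) x) (Fin 2)),
        isSmoothForm_mcoderiv (k := 1) (m := 0) o :=
  fun H ↦ StepMetric.not_isSmoothForm_mcoderiv_stepMetric (H StepMetric.P StepMetric.orient)

end UniversalClosure

end Literature.Geometry.Kaehler
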